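import Literature.NumberTheory.PAdicHodge.LogCyclotomicEll
import Literature.NumberTheory.GaloisRepresentations.LocalKroneckerWeberInertiaProofs
import HarnessLib

/-!
# `log χ_cyclo` is a `ℤ_p`-multiple of the cyclotomic `ℤ_p`-extension character, globally and at a completion

Topic `Literature/NumberTheory/PAdicHodge`; THEOREMS ONLY (no definition, no named fact, no instance, no `sorry`). The calibration
character of Kato's reciprocity law is `ψ = log χ_cyclo : Γ_F → ℚ_p` (LNM 1553, II 1.2.2), while the tree's local-class-field-theory
endpoint (`GaloisCohomology.invPadic_cupProduct_kummerPadic_eq_neg_mul_of_isCyclotomic`, `PAdicHodge.invPadic_twoCocycleClass_eq_neg_mul_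
of_unitKummerLog_presentation`) is stated for `ψ = a · (κ ∘ res_v)` with `κ : Γ_K ↠ ℤ_p` the cyclotomic `ℤ_p`-extension of a number
field `K` (`ZpExtension.IsCyclotomic`: `ker κ = χ_p⁻¹(μ(ℤ_p))`) and `a ∈ ℤ_p`. This file supplies `a`:

* §1 ★ `ZpExtension.exists_toAdd_eq_mul_of_kerSubgroup_le` (any field `K`): **a group homomorphism `f : Γ_K → ℤ_p` killing `ker κ` is
  `a · κ` with `a = f(γ)`, `κ γ = 1`** (every subgroup `pⁿℤ_p` is preserved; a `p`-adic integer is determined by its residues) — the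
  argument of `ZpExtensionUnitTwistProofs` for a not-necessarily-surjective `f`;
* §2 ★ `ZpExtension.IsCyclotomic.exists_ell_cyclotomicCharacter_eq_mul` — **`ℓ(χ_p σ) = a · κ σ`** for the normalised logarithm
  `ℓ = CyclotomicZp.ell` (`ker ℓ = μ(ℤ_p) ⊇` nothing else is needed: `ℓ ∘ χ_p` kills `ker κ = χ_p⁻¹(μ)`);
* §3 (a `p`-adic field structure on the completion `K_v`) ★★ `exists_logCyclotomic_adicCompletion_eq_mul` — **`log χ_cyclo(τ) =
  a · κ(res_v τ)` in `ℚ_p` for all `τ ∈ Γ_{K_v}`, with ONE `a ∈ ℤ_p`** (`logCyclotomic_eq_ell_mul`: `log χ = ℓ(χ) · log_p γ_cyc`;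
  `cyclotomicCharacter_absGaloisRestrict`: `χ_p(res_v τ) = χ_p(τ)`; `log_p γ_cyc ∈ pℤ_p`), and the packaged continuous `ℤ_p`-valued
  character `exists_continuousMap_logCyclotomic_adicCompletion` (the hypotheses `ψ, hψ, hψκ` of the endpoint theorems, with
  `(ψ τ : ℚ_p) = log χ_cyclo(τ)`).

Line `kato_lever` of crux K★ `stmt-BirchSwinnertonDyer-22226` ((H5) plumbing `χ_{K_v} = χ_K ∘ res`, `log χ = a · κ`); BSD / K★ / [REC]
are NOT proved by any of this.

## References
* K. Kato, LNM 1553 (1993), Ch. II 1.2.2, Lemma 1.4.5. [Kato1993LNM1553]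
* L. C. Washington, *Introduction to Cyclotomic Fields* (1997), §13.1 (`Aut(ℤ_p) = ℤ_pˣ`, `End(ℤ_p) = ℤ_p`). [Washington1997]
* J.-P. Serre, *Abelian ℓ-adic representations and elliptic curves* (1968), Ch. I §1.2 (`χ_ℓ` and restriction). [Serre1968]
-/

noncomputable section

open Field Function IsDedekindDomain NumberField
open scoped NumberField

/-! ## §1 Homomorphisms `Γ_K → ℤ_p` killing `ker κ` are multiples of `κ` -/

namespace Literature.NumberTheory.EllipticCurves.ZpExtension

variable {K : Type} [Field K] {p : ℕ} [Fact p.Prime] (κ : ZpExtension K p)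

/-- If `ker κ ≤ ker f` for a homomorphism `f : Γ_K → ℤ_p`, then `f(κ⁻¹(pⁿℤ_p)) ⊆ pⁿℤ_p`: if `κ τ = pⁿ b`, pick `ρ` with `κ ρ = b`; then
`τ ρ^{-pⁿ} ∈ ker κ ≤ ker f`, so `f τ = pⁿ f ρ`. [cite: Washington1997, §13.1] -/
theorem dvd_toAdd_of_kerSubgroup_le_ker {f : absoluteGaloisGroup K →* Multiplicative ℤ_[p]} (h : κ.kerSubgroup ≤ f.ker)
    (n : ℕ) {τ : absoluteGaloisGroup K} (hτ : (p : ℤ_[p]) ^ n ∣ (κ τ).toAdd) : (p : ℤ_[p]) ^ n ∣ (f τ).toAdd := by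
  obtain ⟨b, hb⟩ := hτ
  obtain ⟨ρ, hρ⟩ := κ.surjective (Multiplicative.ofAdd b)
  rw [coe_toContinuousMonoidHom] at hρ
  have hmem : τ * (ρ ^ (p ^ n))⁻¹ ∈ κ.kerSubgroup := by
    rw [mem_kerSubgroup, map_mul, map_inv, map_pow, mul_inv_eq_one, hρ]
    apply Multiplicative.toAdd.injective
    rw [hb, toAdd_pow, toAdd_ofAdd, nsmul_eq_mul, Nat.cast_pow]
  have hmem' : f (τ * (ρ ^ (p ^ n))⁻¹) = 1 := h hmem
  rw [map_mul, map_inv, map_pow, mul_inv_eq_one] at hmem'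
  refine ⟨(f ρ).toAdd, ?_⟩
  rw [hmem', toAdd_pow, nsmul_eq_mul, Nat.cast_pow]

/-- ★ **A homomorphism `f : Γ_K → ℤ_p` killing `ker κ` is a `ℤ_p`-multiple of `κ`**: `f = a · κ` with `a = f(γ)` for any `γ` with `κ γ = 1`
(both factor through `Γ_K/ker κ ≃ ℤ_p`; an endomorphism of `ℤ_p` preserving every `pⁿℤ_p` is multiplication by a `p`-adic integer —
no continuity or surjectivity of `f` is needed). [cite: Washington1997, §13.1] -/
theorem exists_toAdd_eq_mul_of_kerSubgroup_le {f : absoluteGaloisGroup K →* Multiplicative ℤ_[p]} (h : κ.kerSubgroup ≤ f.ker) :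
    ∃ a : ℤ_[p], ∀ σ, (f σ).toAdd = a * (κ σ).toAdd := by
  obtain ⟨σ₀, hσ₀⟩ := κ.surjective (Multiplicative.ofAdd 1)
  rw [coe_toContinuousMonoidHom] at hσ₀
  refine ⟨(f σ₀).toAdd, fun σ => PadicInt.ext_of_toZModPow.mp fun n => ?_⟩
  rw [← sub_eq_zero, ← map_sub, ← RingHom.mem_ker, PadicInt.ker_toZModPow, Ideal.mem_span_singleton]
  set a : ℕ := (κ σ).toAdd.appr n with ha_def
  have ha : (p : ℤ_[p]) ^ n ∣ (κ σ).toAdd - a := Ideal.mem_span_singleton.mp (PadicInt.appr_spec n _)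
  have hτ : (p : ℤ_[p]) ^ n ∣ (κ (σ * (σ₀ ^ a)⁻¹)).toAdd := by
    rw [map_mul, map_inv, map_pow, toAdd_mul, toAdd_inv, toAdd_pow, hσ₀, toAdd_ofAdd, nsmul_one, ← sub_eq_add_neg]
    exact ha
  have hτ' := κ.dvd_toAdd_of_kerSubgroup_le_ker h n hτ
  rw [map_mul, map_inv, map_pow, toAdd_mul, toAdd_inv, toAdd_pow, nsmul_eq_mul] at hτ'
  have hrw : (f σ).toAdd - (f σ₀).toAdd * (κ σ).toAdd =
      ((f σ).toAdd + -((a : ℤ_[p]) * (f σ₀).toAdd)) - (f σ₀).toAdd * ((κ σ).toAdd - a) := by ring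
  rw [hrw]
  exact dvd_sub hτ' (dvd_mul_of_dvd_right ha _)

/-! ## §2 `ℓ ∘ χ_p = a · κ` for a cyclotomic `κ` -/

/-- ★ **`ℓ(χ_p σ) = a · κ σ` for the cyclotomic `ℤ_p`-extension** (`ℓ = CyclotomicZp.ell`, the normalised logarithm `ℤ_pˣ → ℤ_p` with
`ker ℓ = μ(ℤ_p)`; `ker κ = χ_p⁻¹(μ(ℤ_p))` is killed by `ℓ ∘ χ_p`). [cite: Washington1997, §13.1] [cite: Kato1993LNM1553, Ch. II 1.2.2] -/
theorem IsCyclotomic.exists_ell_cyclotomicCharacter_eq_mul {κ : ZpExtension K p} (hκ : κ.IsCyclotomic) :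
    ∃ a : ℤ_[p], ∀ σ : absoluteGaloisGroup K,
      CyclotomicZp.ell p (GaloisRepresentations.GaloisRep.cyclotomicCharacter K p σ) = a * (κ σ).toAdd := by
  set f : absoluteGaloisGroup K →* Multiplicative ℤ_[p] :=
    (CyclotomicZp.ellHom p).toMonoidHom.comp (GaloisRepresentations.GaloisRep.cyclotomicCharacter K p).toMonoidHom with hf
  have hker : κ.kerSubgroup ≤ f.ker := fun σ hσ => by
    rw [hκ] at hσ
    rw [MonoidHom.mem_ker]
    change Multiplicative.ofAdd (CyclotomicZp.ell p (GaloisRepresentations.GaloisRep.cyclotomicCharacter K p σ)) = 1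
    have h0 : CyclotomicZp.ell p (GaloisRepresentations.GaloisRep.cyclotomicCharacter K p σ) = 0 :=
      (CyclotomicZp.ell_eq_zero_iff p _).2 ((CommGroup.mem_torsion _).1 (Subgroup.mem_comap.1 hσ))
    rw [h0]
    rfl
  obtain ⟨a, ha⟩ := κ.exists_toAdd_eq_mul_of_kerSubgroup_le hker
  exact ⟨a, fun σ => ha σ⟩

end Literature.NumberTheory.EllipticCurves.ZpExtension

/-! ## §3 At a completion `K_v`: `log χ_cyclo(τ) = a · κ(res_v τ)` -/

namespace Literature.NumberTheory.PAdicHodge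

open Literature.NumberTheory.GaloisRepresentations
open Literature.NumberTheory.GaloisRepresentations.IsNonarchimedeanLocalField
open Literature.NumberTheory.EllipticCurves Literature.NumberTheory.EllipticCurves.CyclotomicZp
open Literature.IUT.LogVolume

variable {K : Type} [Field K] [NumberField K] {p : ℕ} [Fact p.Prime]

/-- `log_p γ_cyc` as a `p`-adic INTEGER (`‖log_p γ_cyc‖ ≤ p^{-e₀} ≤ 1`). [cite: Serre1968, Ch. I §1.2] -/
private theorem norm_unitLog_cyclotomicGenerator_le_one :
    ‖unitLog ((cyclotomicGenerator p : ℤ_[p]) : ℚ_[p])‖ ≤ 1 :=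
  (norm_unitLog_cyclotomicGenerator_le p).trans (PadicInt.norm_le_one _)

/-- ★★ **`log χ_cyclo = a · (κ ∘ res_v)` on `Γ_{K_v}`, one `a ∈ ℤ_p`**: for the cyclotomic `ℤ_p`-extension `κ` of a number field `K`
and a field `L ⊇ K` carrying a `p`-adic field structure (a completion `K_v`; instances as binders), there is `a ∈ ℤ_p` with
`log χ_cyclo(τ) = a · κ(res τ)` in `ℚ_p` for all `τ ∈ Γ_L` — `log χ(τ) = ℓ(χ_L τ) · log_p γ_cyc` (`logCyclotomic_eq_ell_mul`),
`χ_K(res τ) = χ_L(τ)` (`cyclotomicCharacter_absGaloisRestrict`), `ℓ ∘ χ_K = a₀ · κ` (§2), `a = a₀ · log_p γ_cyc ∈ ℤ_p`.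
[cite: Kato1993LNM1553, Ch. II 1.2.2 and Lemma 1.4.5] [cite: Serre1968, Ch. I §1.2] -/
theorem exists_logCyclotomic_eq_mul_of_isCyclotomic {κ : ZpExtension K p} (hκ : κ.IsCyclotomic)
    (L : Type) [Field L] [Algebra K L] [ValuativeRel L] [TopologicalSpace L] [IsNonarchimedeanLocalField L] [CharZero L] :
    ∃ a : ℤ_[p], ∀ τ : absoluteGaloisGroup L,
      logCyclotomic (F := L) p τ = ((a * (κ (absGaloisRestrict K L τ)).toAdd : ℤ_[p]) : ℚ_[p]) := by
  obtain ⟨a₀, ha₀⟩ := hκ.exists_ell_cyclotomicCharacter_eq_mul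
  refine ⟨a₀ * ⟨unitLog ((cyclotomicGenerator p : ℤ_[p]) : ℚ_[p]), norm_unitLog_cyclotomicGenerator_le_one⟩, fun τ => ?_⟩
  haveI : NeZero (p : K) := ⟨Nat.cast_ne_zero.2 (Fact.out : p.Prime).ne_zero⟩
  rw [logCyclotomic_eq_ell_mul, ← cyclotomicCharacter_absGaloisRestrict K L p τ, ha₀, PadicInt.coe_mul, PadicInt.coe_mul,
    PadicInt.coe_mul]
  change _ = (a₀ : ℚ_[p]) * unitLog ((cyclotomicGenerator p : ℤ_[p]) : ℚ_[p]) * _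
  ring

/-- ★★ **The calibration character packaged**: for cyclotomic `κ` and `L = K_v` (any `p`-adic field structure over `K`) there are
`a ∈ ℤ_p` and a CONTINUOUS additive `ψ : Γ_L → ℤ_p` with `ψ(τ) = a · κ(res τ)` and `(ψ τ : ℚ_p) = log χ_cyclo(τ)` — verbatim the
hypotheses `(a, ψ, hψ, hψκ)` of `GaloisCohomology.invPadic_cupProduct_kummerPadic_eq_neg_mul_of_isCyclotomic` and
`PAdicHodge.invPadic_twoCocycleClass_eq_neg_mul_of_unitKummerLog_presentation`, for Kato's `ψ = log χ_cyclo`.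
[cite: Kato1993LNM1553, Ch. II 1.2.2 and Lemma 1.4.5] -/
theorem exists_continuousMap_logCyclotomic_of_isCyclotomic {κ : ZpExtension K p} (hκ : κ.IsCyclotomic)
    (L : Type) [Field L] [Algebra K L] [ValuativeRel L] [TopologicalSpace L] [IsNonarchimedeanLocalField L] [CharZero L] :
    ∃ (a : ℤ_[p]) (ψ : C(absoluteGaloisGroup L, ℤ_[p])), (∀ σ τ, ψ (σ * τ) = ψ σ + ψ τ) ∧
      (∀ τ, ψ τ = a * (κ (absGaloisRestrict K L τ)).toAdd) ∧ ∀ τ, (ψ τ : ℚ_[p]) = logCyclotomic (F := L) p τ := by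
  obtain ⟨a, ha⟩ := exists_logCyclotomic_eq_mul_of_isCyclotomic hκ L
  refine ⟨a, ⟨fun τ => a * (κ (absGaloisRestrict K L τ)).toAdd,
    continuous_const.mul (continuous_toAdd.comp ((map_continuous κ).comp (absGaloisRestrict K L).continuous))⟩,
    fun σ τ => ?_, fun τ => rfl, fun τ => (ha τ).symm⟩
  change a * (κ (absGaloisRestrict K L (σ * τ))).toAdd = a * _ + a * _
  rw [map_mul, map_mul, toAdd_mul, mul_add]

end Literature.NumberTheory.PAdicHodge

end
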